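import Summits.Ventures.HodgeRepro2.T6N43ExplicitToy

/-!
# T6N43ExplicitToyEq — the explicit toy bundle IS the accepted toy bundle

`N43Toy.explicitToy.toPlaces = N43Places.toy` (`explicitToy_toPlaces`): the explicit toys of
T6N43ExplicitToy.lean (coefficients produced by the Fock-line datum `fockLineToy` / the polynomial Fock
model through `deltaCoeff`) have, field by field, the data of the accepted toys `N43Toy.toyU2` /
`N43Toy.toyU11` of T6N43Toy.lean (the same measures, matrices, coefficient functions, norms and L-factors;
the Prop fields by proof irrelevance). Consequence for the M2 v4 toy (the lead's `NAutToy.toyNSide`,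
whose `d43` is `N43Places.toy`): the binder `hx : toyNSide.d43 = explicitToy.toPlaces` of
`periodInputN_of_published₄` is `explicitToy_toPlaces.symm` — README §10.5(ii)(d) for v4 on the EXISTING
toy carrier, no lead-side change (`toy_hx`). Also `ArchDoublingDatum.ext'` (a datum is determined by its
seven data fields). No display, no new definition. Axioms: {propext, Classical.choice, Quot.sound}.
§8(d): uses an L-value-free non-vanishing device: NO.
-/

namespace Summit.Ventures.HodgeRepro2.T6

open MeasureTheory Complex
open scoped InnerProductSpace

namespace ArchDoublingDatum

variable {H : Type*} [MeasurableSpace H] {P : Matrix (Fin 2) (Fin 2) ℂ → Prop}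

/-- Two doubling data with the same seven data fields are equal (the Prop fields by proof
irrelevance). -/
theorem ext' {𝒟 𝒟' : ArchDoublingDatum H P} (hμ : 𝒟.μ = 𝒟'.μ) (hrep : 𝒟.rep = 𝒟'.rep)
    (hW : 𝒟.coeffW = 𝒟'.coeffW) (hπ : 𝒟.coeffπ = 𝒟'.coeffπ) (hφ : 𝒟.normφ = 𝒟'.normφ)
    (hf : 𝒟.normf = 𝒟'.normf) (hL : 𝒟.Lfac = 𝒟'.Lfac) : 𝒟 = 𝒟' := by
  cases 𝒟
  cases 𝒟'
  simp only at hμ hrep hW hπ hφ hf hL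
  subst hμ hrep hW hπ hφ hf hL
  rfl

end ArchDoublingDatum

namespace N43Toy

/-- The explicit compact toy's coefficients are `1` (the compact toy's). -/
theorem explicitU2_coeff (g : Unit) :
    explicitU2.datum.coeffW g = 1 ∧ explicitU2.datum.coeffπ g = 1 := by
  constructor
  · show ⟪deltaCoeff Delta, deltaCoeff (fockActU2 0 (1 : Matrix (Fin 2) (Fin 2) ℂ) Delta)⟫_ℂ = 1
    simp [fockActU2_one_Delta, deltaCoeff_Delta]
  · show ⟪deltaCoeff ((1 : ℂ) • Delta),
      deltaCoeff (fockActU2 0 (1 : Matrix (Fin 2) (Fin 2) ℂ) ((1 : ℂ) • Delta))⟫_ℂ = 1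
    simp [fockActU2_one_Delta, deltaCoeff_Delta]

/-- The explicit compact toy IS the accepted compact toy. -/
theorem explicitU2_datum_eq : explicitU2.datum = toyU2 := by
  refine ArchDoublingDatum.ext' rfl rfl (funext fun g => ?_) (funext fun g => ?_) ?_ ?_ rfl
  · exact (explicitU2_coeff g).1
  · exact (explicitU2_coeff g).2
  · show ‖deltaCoeff Delta‖ = 1
    rw [deltaCoeff_Delta, norm_one]
  · show ‖deltaCoeff ((1 : ℂ) • Delta)‖ = 1
    rw [one_smul, deltaCoeff_Delta, norm_one]

/-- The explicit Cartan-line toy's `coeffW` is `cosh(η/2)^{−3}` (as its `coeffπ`, `explicitU11_coeffπ`). -/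
theorem explicitU11_coeffW (g : ℝ) :
    explicitU11.datum.coeffW g =
      ((Real.cosh ((2 * Real.arsinh ‖T5UnitaryBound.hyperbolicC (g / 2) 1 0‖) / 2) ^ (-3 : ℤ) : ℝ) : ℂ) := by
  show ⟪(1 : ℂ), ((Real.cosh ((2 * Real.arsinh ‖T5UnitaryBound.hyperbolicC (g / 2) 1 0‖) / 2) ^ (-3 : ℤ) : ℝ) : ℂ) •
    (1 : ℂ)⟫_ℂ = _
  rw [inner_smul_right, inner_self_eq_norm_sq_to_K, norm_one, RCLike.ofReal_one, one_pow, mul_one]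

/-- The explicit Cartan-line toy IS the accepted Cartan-line toy. -/
theorem explicitU11_datum_eq : explicitU11.datum = toyU11 := by
  refine ArchDoublingDatum.ext' rfl rfl (funext fun g => ?_) (funext fun g => ?_) ?_ ?_ rfl
  · exact explicitU11_coeffW g
  · exact explicitU11_coeffπ g
  · show ‖(1 : ℂ)‖ = 1
    exact norm_one
  · show ‖(1 : ℂ)‖ = 1
    exact norm_one

/-- The explicit toy bundle IS the accepted toy bundle. -/
theorem explicitToy_toPlaces : explicitToy.toPlaces = N43Places.toy := by
  have key : ∀ (d₁ : ArchDoublingDatum Unit (· ∈ Matrix.unitaryGroup (Fin 2) ℂ))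
      (p : IsProbabilityMeasure d₁.μ) (d₂ d₃ : ArchDoublingDatum ℝ T5UnitaryBound.MemU11),
      d₁ = toyU2 → d₂ = toyU11 → d₃ = toyU11 →
      N43Places.mk Unit d₁ p 0 0 0 0 ℝ d₂ 0 0 0 ℝ d₃ 0 0 0 = N43Places.toy := by
    rintro d₁ p d₂ d₃ rfl rfl rfl
    rfl
  exact key _ explicitU2.datum_prob _ _ explicitU2_datum_eq explicitU11_datum_eq explicitU11_datum_eq

/-- The M2 v4 binder `hx` for the lead's toy side (`d43 = N43Places.toy`), in the direction v4 states it. -/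
theorem toy_hx : N43Places.toy = explicitToy.toPlaces :=
  explicitToy_toPlaces.symm

end N43Toy

end Summit.Ventures.HodgeRepro2.T6
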